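import Literature.MathematicalPhysics.QuantumFieldTheory.BalabanImbrieJaffe1984to88.BIJ88TruncatedExpectation5142
import Literature.MathematicalPhysics.QuantumFieldTheory.BalabanImbrieJaffe1984to88.BIJ88PertTerms5141

/-!
# `BalabanImbrieJaffe1984to88.BIJ88TruncatedExpectation5142Family` — [BalabanImbrieJaffe1988] CMP **114** (1988), Sect. 5.14 p. 308:
**`⟨d/dt; …; d/dt⟩_t = (d/dt)^{n̄+1} log z_t` and (5.14.2) FOR THE RESTRICTED INTERACTING FAMILY** `z_t = ∫ χ′_{Λ,t} e^{−tṼ} dP` of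
p. 308 — the sibling `BIJ88TruncatedExpectation5142` (truncated functions of the `t`-derivative insertions = log-derivatives, for any
positive smooth `z`) INSTANTIATED with no standing hypothesis beyond this seat's gen-7/8 ones (non-negative profile `χ(1,·) ≥ 0`,
`p > 1/2`, centered jointly Gaussian fields, radii `c_b ≥ c₀ > 0`, measurable `|Ṽ| ≤ K`, `0 < e_k < e^{−1}`).

statement-level skeleton of published theorems with citation tags; proofs where landed; nothing here is a claim about the Yang–Mills mass gap

THE PRINT (verbatim, p. 308 [PDF 52], image `lit-balaban-r16/renders/cmp114/original-p052-x2.png`): *"Define z_t(Λ₁₂^{(k)}) for t ∈ [0,1] by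
replacing Ṽ(Λ₁₂^{(k)}) with tṼ(Λ₁₂^{(k)}), replacing χ(cp(e_k), (I−Q^{s*}Q)A^{(k)}) with χ(cp(te_k), (I−Q^{s*}Q)A^{(k)}), and similarly for
χ(cp(e_k), φ^{(k)}). Thus the restrictions and the interactions disappear at t = 0, at which point we have a purely Gaussian expectation.
… and a remainder ℛ_k(Λ₁₂^{(k)}) = ∫₀¹ dt −((1−t)^{n̄}/(n̄+1)!) ⟨d/dt; …; d/dt⟩_t. (5.14.2)"*

WHAT IS PROVED (theorems only; the family written out as in `BIJ88ZtPositivity308`/`BIJ88PertTerms5141`: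
`z t = ∫ (Π_{b∈Λ} χ(c_b p(te_k), Φ_b)) e^{−tW} dP`).
* `integral_restrictedInteraction_pos_uIcc` — `z_t > 0` on ALL of `[0,1]` (`z_0 = 1`,
  `BIJ88PertTerms5141.integral_restrictedInteraction_at_zero`; `z_t > 0` on `(0,1]`, `BIJ88ZtPositivity308.integral_restrictedInteraction_pos`).
* `contDiffOn_uIcc_restrictedInteraction` — `z ∈ Cⁿ([0,1])` for every `n` (`z = exp(log z)`, `log z ∈ Cⁿ([0,1])` =
  `BIJ88PertTerms5141.contDiffOn_Icc_log_restrictedInteraction'`).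
* **`trunc_univ_eq_restrictedInteraction`** — for every `t ∈ [0,1]` and every solution `κ_t` of p. 310 display 2 against the moments
  `⟨(d/dt)^{|K|}⟩_t = z_t^{(|K|)}/z_t`, `∅ ≠ K ⊆ H`, `|H| = n̄+1`: `κ_t(H) = (d/dt)^{n̄+1} log z_t` (one-sided at the end points).
* **`effectiveAction_eq_pertP_add_truncRemainder`** — `−log z₁ = 𝒫̃_{k+1} + ∫₀¹ −((1−t)^{n̄}/n̄!) ⟨d/dt;…;d/dt⟩_t dt`:
  (5.14.1)–(5.14.2) for the family with the display-2 truncated expectation and Taylor's weight `n̄!`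
  (r16's `pertP`; the printed `(n̄+1)!` weight gives the remainder
  divided by `n̄+1`, sibling file `logz_split_trunc`).

HONEST SCOPE.  As in the sibling file: the moments are the normalized `t`-derivatives of `z` (= `∫ ∂ⁿ_t(χ′_t e^{−tṼ}) dP / z_t` by this seat's
all-orders exchange theorems, not re-derived here); nothing of (5.14.3)/(5.14.4) is used or asserted.  0 `sorry`; axioms standard.

CITATION HEADER (lean-in-tree rule).  lit-balaban TYPED SKELETON (HOME `run/shared/lean/pub/lit-balaban/`), Phase 2, seat p36 gen 9
(unit `lit-balaban-p36`); row **C2.Eq5.14.1-5.14.2** of `HOME/lit-balaban-r16/ROWS-C2-part2.md` (owner r16; head untouched).  PDF held: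
`paper:balaban1988-cmp114-bij-abelian-higgs-effective-action` (journal page = PDF page + 256).  NOT summit progress.
-/

open Finset MeasureTheory ProbabilityTheory
open Literature.Probability.LatticeModels (setPartitions)
open Literature.MathematicalPhysics.QuantumFieldTheory.BalabanImbrieJaffe1984to88.BIJ88Sect5StatementsPart4 (pertP)

namespace Literature.MathematicalPhysics.QuantumFieldTheory.BalabanImbrieJaffe1984to88.BIJ88TruncatedExpectation5142

/-! ## The restricted interacting family of p. 308 -/

section Family

open BIJ88Sect2Statements (pLog)
open BIJ88Sect5Statements (CutoffProfile cutoff)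

variable (χ : CutoffProfile) {ι Ω : Type*} [MeasurableSpace Ω] {H : Type*} [Fintype H] [DecidableEq H]

/-- **`z_t > 0` on all of `[0,1]`** for the restricted interacting family `z_t = ∫ χ′_{Λ,t} e^{−tṼ} dP` (non-negative profile,
centered jointly Gaussian fields, `c_b ≥ c₀ > 0`, `|Ṽ| ≤ K`, `0 < e_k ≤ e^{−1}`): `z_0 = 1` and `z_t > 0` on `(0,1]`
(`BIJ88ZtPositivity308`). [cite: BalabanImbrieJaffe1988, (5.14.2) p.308] -/
theorem integral_restrictedInteraction_pos_uIcc (hχ : ∀ x, 0 ≤ χ.χ₁ x) {p : ℝ} (hp : 0 < p) (P : Measure Ω)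
    [IsProbabilityMeasure P] (B : Finset ι) {Φ : ι → Ω → ℝ} (hJ : HasGaussianLaw (fun ω (b : B) => Φ b ω) P)
    (hΦ : ∀ b ∈ B, Measurable (Φ b)) (h0 : ∀ b ∈ B, P[Φ b] = 0) {c : ι → ℝ} {c₀ : ℝ} (hc₀ : 0 < c₀) (hcb : ∀ b ∈ B, c₀ ≤ c b)
    {W : Ω → ℝ} (hW : Measurable W) {K : ℝ} (hK : ∀ ω, |W ω| ≤ K) {ek : ℝ} (hek : 0 < ek) (hek1 : ek ≤ Real.exp (-1))
    {t : ℝ} (ht : t ∈ Set.uIcc (0 : ℝ) 1) :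
    0 < ∫ ω, (∏ b ∈ B, cutoff χ (c b * pLog p (t * ek)) (Φ b ω)) * Real.exp (-(t * W ω)) ∂P := by
  rw [Set.uIcc_of_le zero_le_one] at ht
  rcases ht.1.eq_or_lt with rfl | ht0
  · rw [BIJ88PertTerms5141.integral_restrictedInteraction_at_zero χ hp.ne' P B Φ c W ek]
    exact one_pos
  · exact BIJ88ZtPositivity308.integral_restrictedInteraction_pos χ hχ hp.le P B hJ hΦ h0 hc₀ hcb hW hK hek ht0
      (BIJ88ZtPositivity308.mul_le_exp_neg_one_of_Ioc hek hek1 ⟨ht0, ht.2⟩)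

/-- **`z ∈ Cⁿ([0,1])` for every `n`** (one-sided at the end points) for the restricted interacting family: `z = exp(log z)` with
`log z ∈ Cⁿ([0,1])` (`BIJ88PertTerms5141.contDiffOn_Icc_log_restrictedInteraction'`). [cite: BalabanImbrieJaffe1988, (5.14.2) p.308] -/
theorem contDiffOn_uIcc_restrictedInteraction (hχ : ∀ x, 0 ≤ χ.χ₁ x) {p : ℝ} (hp : 1 / 2 < p) (P : Measure Ω)
    [IsProbabilityMeasure P] (B : Finset ι) {Φ : ι → Ω → ℝ} (hJ : HasGaussianLaw (fun ω (b : B) => Φ b ω) P)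
    (hΦ : ∀ b ∈ B, Measurable (Φ b)) (h0 : ∀ b ∈ B, P[Φ b] = 0) {c : ι → ℝ} {c₀ : ℝ} (hc₀ : 0 < c₀) (hcb : ∀ b ∈ B, c₀ ≤ c b)
    {W : Ω → ℝ} (hW : Measurable W) {K : ℝ} (hK : ∀ ω, |W ω| ≤ K) {ek : ℝ} (hek : 0 < ek) (hek1 : ek < Real.exp (-1))
    (n : ℕ) :
    ContDiffOn ℝ n (fun t => ∫ ω, (∏ b ∈ B, cutoff χ (c b * pLog p (t * ek)) (Φ b ω)) * Real.exp (-(t * W ω)) ∂P)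
      (Set.uIcc 0 1) := by
  have hlog := BIJ88PertTerms5141.contDiffOn_Icc_log_restrictedInteraction' χ hχ hp P B hJ hΦ h0 hc₀ hcb hW hK hek hek1 n
  rw [Set.uIcc_of_le zero_le_one]
  refine hlog.exp.congr fun t ht => ?_
  exact (Real.exp_log (integral_restrictedInteraction_pos_uIcc χ hχ (by linarith) P B hJ hΦ h0 hc₀ hcb hW hK hek hek1.le
    (by rwa [Set.uIcc_of_le zero_le_one]))).symm

/-- **For the restricted interacting family, the display-2 truncated expectation of the `n̄+1` insertions `d/dt` IS
`(d/dt)^{n̄+1} log z_t` on `[0,1]`** — no standing hypothesis beyond the gen-7/8 ones of this seat (non-negative profile,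
`p > 1/2`, centered jointly Gaussian fields, `c_b ≥ c₀ > 0`, measurable `|Ṽ| ≤ K`, `0 < e_k < e^{−1}`).
[cite: BalabanImbrieJaffe1988, (5.14.2) p.308; p.310 display 2] -/
theorem trunc_univ_eq_restrictedInteraction (hχ : ∀ x, 0 ≤ χ.χ₁ x) {p : ℝ} (hp : 1 / 2 < p) (P : Measure Ω)
    [IsProbabilityMeasure P] (B : Finset ι) {Φ : ι → Ω → ℝ} (hJ : HasGaussianLaw (fun ω (b : B) => Φ b ω) P)
    (hΦ : ∀ b ∈ B, Measurable (Φ b)) (h0 : ∀ b ∈ B, P[Φ b] = 0) {c : ι → ℝ} {c₀ : ℝ} (hc₀ : 0 < c₀) (hcb : ∀ b ∈ B, c₀ ≤ c b)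
    {W : Ω → ℝ} (hW : Measurable W) {K : ℝ} (hK : ∀ ω, |W ω| ≤ K) {ek : ℝ} (hek : 0 < ek) (hek1 : ek < Real.exp (-1))
    {nbar : ℕ} (hH : Fintype.card H = nbar + 1) {κ : ℝ → Finset H → ℝ}
    (hκ : ∀ t ∈ Set.uIcc (0 : ℝ) 1, ∀ S : Finset H, S.Nonempty →
      iteratedDerivWithin S.card
          (fun t => ∫ ω, (∏ b ∈ B, cutoff χ (c b * pLog p (t * ek)) (Φ b ω)) * Real.exp (-(t * W ω)) ∂P) (Set.uIcc 0 1) t /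
        (∫ ω, (∏ b ∈ B, cutoff χ (c b * pLog p (t * ek)) (Φ b ω)) * Real.exp (-(t * W ω)) ∂P)
        = ∑ π ∈ setPartitions S, ∏ A ∈ π, κ t A)
    {t : ℝ} (ht : t ∈ Set.uIcc (0 : ℝ) 1) :
    κ t univ = iteratedDerivWithin (nbar + 1)
      (fun t => Real.log (∫ ω, (∏ b ∈ B, cutoff χ (c b * pLog p (t * ek)) (Φ b ω)) * Real.exp (-(t * W ω)) ∂P))
      (Set.uIcc 0 1) t :=
  trunc_univ_eq_iteratedDerivWithin_log hH
    (contDiffOn_uIcc_restrictedInteraction χ hχ hp P B hJ hΦ h0 hc₀ hcb hW hK hek hek1 (nbar + 1))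
    (fun s hs => integral_restrictedInteraction_pos_uIcc χ hχ (by linarith) P B hJ hΦ h0 hc₀ hcb hW hK hek hek1.le hs) hκ ht

/-- **(5.14.1)–(5.14.2) for the restricted interacting family with the display-2 truncated expectation and Taylor's weight**:
`−log z₁ = 𝒫̃_{k+1} + ∫₀¹ −((1−t)^{n̄}/n̄!) ⟨d/dt;…;d/dt⟩_t dt` (`log z_0 = 0`; hypotheses as above).
[cite: BalabanImbrieJaffe1988, (5.14.2) p.308; p.310 display 2] -/
theorem effectiveAction_eq_pertP_add_truncRemainder (hχ : ∀ x, 0 ≤ χ.χ₁ x) {p : ℝ} (hp : 1 / 2 < p) (P : Measure Ω)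
    [IsProbabilityMeasure P] (B : Finset ι) {Φ : ι → Ω → ℝ} (hJ : HasGaussianLaw (fun ω (b : B) => Φ b ω) P)
    (hΦ : ∀ b ∈ B, Measurable (Φ b)) (h0 : ∀ b ∈ B, P[Φ b] = 0) {c : ι → ℝ} {c₀ : ℝ} (hc₀ : 0 < c₀) (hcb : ∀ b ∈ B, c₀ ≤ c b)
    {W : Ω → ℝ} (hW : Measurable W) {K : ℝ} (hK : ∀ ω, |W ω| ≤ K) {ek : ℝ} (hek : 0 < ek) (hek1 : ek < Real.exp (-1))
    {nbar : ℕ} (hH : Fintype.card H = nbar + 1) {κ : ℝ → Finset H → ℝ}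
    (hκ : ∀ t ∈ Set.uIcc (0 : ℝ) 1, ∀ S : Finset H, S.Nonempty →
      iteratedDerivWithin S.card
          (fun t => ∫ ω, (∏ b ∈ B, cutoff χ (c b * pLog p (t * ek)) (Φ b ω)) * Real.exp (-(t * W ω)) ∂P) (Set.uIcc 0 1) t /
        (∫ ω, (∏ b ∈ B, cutoff χ (c b * pLog p (t * ek)) (Φ b ω)) * Real.exp (-(t * W ω)) ∂P)
        = ∑ π ∈ setPartitions S, ∏ A ∈ π, κ t A) :
    -Real.log (∫ ω, (∏ b ∈ B, cutoff χ (c b * pLog p (1 * ek)) (Φ b ω)) * Real.exp (-(1 * W ω)) ∂P) =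
      pertP (fun t => Real.log (∫ ω, (∏ b ∈ B, cutoff χ (c b * pLog p (t * ek)) (Φ b ω)) * Real.exp (-(t * W ω)) ∂P)) nbar
        + ∫ t in (0 : ℝ)..1, -((1 - t) ^ nbar / nbar.factorial) * κ t univ := by
  have h := eq5142_taylorWeight hH
    (contDiffOn_uIcc_restrictedInteraction χ hχ hp P B hJ hΦ h0 hc₀ hcb hW hK hek hek1 (nbar + 1))
    (fun s hs => integral_restrictedInteraction_pos_uIcc χ hχ (by linarith) P B hJ hΦ h0 hc₀ hcb hW hK hek hek1.le hs) hκ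
  rw [BIJ88PertTerms5141.integral_restrictedInteraction_at_zero χ (by linarith : p ≠ 0), Real.log_one, zero_sub] at h
  linarith

end Family

end Literature.MathematicalPhysics.QuantumFieldTheory.BalabanImbrieJaffe1984to88.BIJ88TruncatedExpectation5142
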